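import Summits.BirchSwinnertonDyer.BirchSwinnertonDyer.Theorems.ManinLocalTwoThreeShiftSpanOldform
import HarnessLib

/-!
# Route `ManinLocalTwoThree`, crux C3 `ManinPrimeToThreeAtNine` (stmt-BirchSwinnertonDyer-22968), line `kato-shift-three`
# (es g6/g9): E-es-19 `ShiftClassGenerationThree` (admissible primes) ⟺ ALL-SHIFT generation (E-es-26 at `(p,t,n,D) =
# (3,3,1,9)`, MEMO-es §21: every prime `ℓ ∤ 3N`, no Legendre condition) — the content of the es line
# `shiftgen3-diamond-split`'s stub S3 `stub_admissible_of_allShiftGeneration`, proved (line prover p3; helper, unconditional)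

MEMO-es §21.3 reduces E-es-19 to the cohomological relative Ihara lemma E-es-25 through E-es-26
`PrimePowerShiftGenerationAbove 3 3 1 9` («some `m`, `3 ∤ m`, puts `m·Λ_f` in the span of ALL shift classes
`{0, 3a/ℓ}_f − {0, a/ℓ}_f`, `ℓ ≥ ℓ₀` prime, `ℓ ∤ 3N`») and the step S3 «all-shift generation ⟹ admissible generation».
S3 is proved here, with E-es-26's body INLINED (its `def` lives in the es sketch, not yet in the tree; `powShiftClass f 3 1 ℓ a`
unfolded to `primeClass f ℓ (3^1·a) − primeClass f ℓ a`):
* `shiftClassGenerationThree_of_allShiftGeneration` — all-shift generation (for any one `ℓ₀`, e.g. all `ℓ₀`) ⟹ E-es-19: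
  every shift class is a period of the oldform `h = f∣ι₃ − f∣ι₁` on `Γ₀(3N)` (`periodLattice_shiftOldform_eq_closure_columns`),
  so `m·Λ_f ⊆ Λ_h`, and `shiftClassGenerationThree_iff_oldformLattice` concludes;
* `allShiftGeneration_of_shiftClassGenerationThree` — the converse (admissible classes are among all classes; es's
  `primePowerShiftGenerationAbove_three_of_shiftClassGenerationThree`, restated over the inlined body);
* `shiftClassGenerationThree_iff_allShiftGeneration` — the equivalence.
Nothing about BSD, Manin's conjecture or E-es-19 itself is proved here.
-/

set_option autoImplicit false
set_option linter.dupNamespace false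

noncomputable section

open scoped Classical MatrixGroups ModularForm BigOperators

open CongruenceSubgroup Matrix.SpecialLinearGroup ModularGroup
  Literature.NumberTheory.EllipticCurves Literature.NumberTheory.EllipticCurves.ModularForms
  Summit.BirchSwinnertonDyer.Rank1Residual.ManinAdditive

namespace Summit.BirchSwinnertonDyer.BirchSwinnertonDyer.Theorems.ManinLocalTwoThree

/-- **All-shift generation ⟹ E-es-19** (stub S3 of the es line `shiftgen3-diamond-split`, E-es-26`(3,3,1,9)` inlined):
if for every `W`-newform `f` of level `N` with `9 ∣ N` and `W[3]` irreducible and every `ℓ₀` some `m` with `3 ∤ m` puts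
`m·Λ_f` in the span of ALL shift classes `{0, 3a/ℓ}_f − {0, a/ℓ}_f` (`ℓ ≥ ℓ₀` prime, `ℓ ∤ 3N`, `0 < a < ℓ`), then
`ShiftClassGenerationThree` (admissible primes only) holds — via the oldform lattice `Λ_{f∣ι₃ − f∣ι₁}`. [folklore] -/
theorem shiftClassGenerationThree_of_allShiftGeneration
    (H : ∀ (W : WeierstrassCurve ℚ) [W.IsElliptic] {N : ℕ} [NeZero N] (f : CuspForm (Gamma0 N) 2) (ℓ₀ : ℕ),
      IsNewformOf W f → 9 ∣ N → W.HasIrreducibleModPGaloisRep 3 →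
      ∃ m : ℕ, ¬ 3 ∣ m ∧ ∀ z ∈ periodLattice f, (m : ℂ) * z ∈ AddSubgroup.closure
        {z : ℂ | ∃ ℓ : ℕ, ℓ₀ ≤ ℓ ∧ ℓ.Prime ∧ ¬ ℓ ∣ 3 * N ∧
          ∃ a : ℕ, 0 < a ∧ a < ℓ ∧ z = primeClass f ℓ (3 ^ 1 * a) - primeClass f ℓ a}) :
    ShiftClassGenerationThree := by
  rw [shiftClassGenerationThree_iff_oldformLattice]
  intro W _ N _ f hf h9 hirr
  have h9' : 9 ∣ N := by norm_num at h9; exact h9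
  have h3 : 3 ∣ N := dvd_trans (by norm_num) h9'
  obtain ⟨m, hm, hgen⟩ := H W f 0 hf h9' hirr
  refine ⟨m, hm, fun z hz => ?_⟩
  refine (AddSubgroup.closure_le _).mpr ?_ (hgen z hz)
  rintro w ⟨ℓ, -, hℓp, hℓN, a, ha0, ha, rfl⟩
  rw [SetLike.mem_coe, periodLattice_shiftOldform_eq_closure_columns f h3]
  apply AddSubgroup.subset_closure
  have hℓN' : ¬ ℓ ∣ N := fun h => hℓN (dvd_mul_of_dvd_right h 3)
  have hℓa : ¬ ℓ ∣ a := fun h => absurd (Nat.le_of_dvd ha0 h) (not_le.mpr ha)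
  refine ⟨a, ℓ, by exact_mod_cast hℓp.ne_zero, ?_, ?_⟩
  · refine IsCoprime.mul_right ?_ ?_
    · rw [Int.isCoprime_iff_gcd_eq_one, Int.gcd_natCast_natCast]
      exact (Nat.Prime.coprime_iff_not_dvd hℓp).mpr hℓN'
    · rw [Int.isCoprime_iff_gcd_eq_one, Int.gcd_natCast_natCast]
      exact (Nat.Prime.coprime_iff_not_dvd hℓp).mpr hℓa
  · simp only [primeClass, pow_one]
    push_cast
    ring

/-- **E-es-19 ⟹ all-shift generation** (the admissible shift classes are among all shift classes; es g9's
`primePowerShiftGenerationAbove_three_of_shiftClassGenerationThree` over the inlined body). [folklore] -/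
theorem allShiftGeneration_of_shiftClassGenerationThree (h : ShiftClassGenerationThree) :
    ∀ (W : WeierstrassCurve ℚ) [W.IsElliptic] {N : ℕ} [NeZero N] (f : CuspForm (Gamma0 N) 2) (ℓ₀ : ℕ),
      IsNewformOf W f → 9 ∣ N → W.HasIrreducibleModPGaloisRep 3 →
      ∃ m : ℕ, ¬ 3 ∣ m ∧ ∀ z ∈ periodLattice f, (m : ℂ) * z ∈ AddSubgroup.closure
        {z : ℂ | ∃ ℓ : ℕ, ℓ₀ ≤ ℓ ∧ ℓ.Prime ∧ ¬ ℓ ∣ 3 * N ∧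
          ∃ a : ℕ, 0 < a ∧ a < ℓ ∧ z = primeClass f ℓ (3 ^ 1 * a) - primeClass f ℓ a} := by
  intro W _ N _ f ℓ₀ hf h9 hirr
  obtain ⟨m, hm, hmem⟩ := h W f ℓ₀ hf (by norm_num; exact h9) hirr
  refine ⟨m, hm, fun z hz => AddSubgroup.closure_mono ?_ (hmem z hz)⟩
  rintro w ⟨ℓ, ⟨hℓ₀, hℓp, hℓN, hℓ12, -⟩, a, ha0, ha, rfl⟩
  refine ⟨ℓ, hℓ₀, hℓp, ?_, a, ha0, ha, ?_⟩
  · intro hdvd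
    rcases (Nat.Prime.dvd_mul hℓp).mp hdvd with h3 | hN'
    · have : ℓ = 3 := (Nat.prime_dvd_prime_iff_eq hℓp Nat.prime_three).mp h3
      omega
    · exact hℓN hN'
  · simp [primeClass, pow_one]

/-- **E-es-19 ⟺ all-shift generation** (E-es-26 at `(3,3,1,9)`, body inlined). [folklore] -/
theorem shiftClassGenerationThree_iff_allShiftGeneration :
    ShiftClassGenerationThree ↔
      ∀ (W : WeierstrassCurve ℚ) [W.IsElliptic] {N : ℕ} [NeZero N] (f : CuspForm (Gamma0 N) 2) (ℓ₀ : ℕ),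
        IsNewformOf W f → 9 ∣ N → W.HasIrreducibleModPGaloisRep 3 →
        ∃ m : ℕ, ¬ 3 ∣ m ∧ ∀ z ∈ periodLattice f, (m : ℂ) * z ∈ AddSubgroup.closure
          {z : ℂ | ∃ ℓ : ℕ, ℓ₀ ≤ ℓ ∧ ℓ.Prime ∧ ¬ ℓ ∣ 3 * N ∧
            ∃ a : ℕ, 0 < a ∧ a < ℓ ∧ z = primeClass f ℓ (3 ^ 1 * a) - primeClass f ℓ a} :=
  ⟨allShiftGeneration_of_shiftClassGenerationThree, shiftClassGenerationThree_of_allShiftGeneration⟩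

end Summit.BirchSwinnertonDyer.BirchSwinnertonDyer.Theorems.ManinLocalTwoThree

end
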